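import Literature.Computability.Complexity.CodeFPLists
import Literature.Computability.Complexity.KSATReductions
import Literature.Computability.Complexity.ClayProblemProofs
import Literature.Computability.Complexity.CountingReductions
import HarnessLib

/-!
# MAX 2-SAT is NP-hard (Garey–Johnson–Stockmeyer 1976): the language `MAX2SAT`, the ten-clause
gadget, and `3SAT ≤ₚ MAX2SAT`

Trunk `CplxCore` (topic `Computability/Complexity`). The decision version of MAX 2-SAT — given a
2-CNF `φ` (every clause has exactly two literal occurrences, repetitions allowed: a unit clause `a`
is written `a ∨ a`) and a threshold `b`, does some assignment satisfy at least `b` clauses? — as a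
Boolean language `MAX2SAT` (codes of pairs `(φ, b)`, `encodingCNF.pairBool encodingNatBool`), and
its NP-hardness **`MAX2SAT_isNPHard`** by the Garey–Johnson–Stockmeyer reduction from `3SAT`
(the tree's `kSAT 3`, NP-complete by `isNPComplete_kSAT_three_holds`, Arora–Barak Thm. 2.10 (2)):
a clause `a ∨ b ∨ c` with a fresh variable `d` becomes the ten clauses
`a, b, c, d, ¬a ∨ ¬b, ¬a ∨ ¬c, ¬b ∨ ¬c, a ∨ ¬d, b ∨ ¬d, c ∨ ¬d`, of which at most `7` are
simultaneously satisfiable, exactly `7` iff `a ∨ b ∨ c` holds (for a suitable `d`), and at most `6`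
otherwise; so `φ` with `m` clauses is satisfiable iff `7m` clauses of the 2-CNF can be satisfied
(Garey–Johnson–Stockmeyer 1976, Thm. 1.1, p. 240 — including the padding of short clauses "by
repeating one of the literals which it contains"; Garey–Johnson [LO5]; Papadimitriou 1994, Thm. 9.2).

* `CNF.numSatClauses φ σ` — the number of clauses of `φ` satisfied by `σ` (the MAX-SAT objective;
  the tree's `CNF.satisfiedFraction` is this count divided by the number of clauses);
* `encodingCNFNat`, **`MAX2SAT`**, `mem_MAX2SAT_iff`;
* the gadget: `MaxTwoSat.slot` (the three slots of a clause of width `≤ 3`, padded by repeating the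
  last literal — truth-functionally harmless), `MaxTwoSat.gadget`, `MaxTwoSat.gadgetCount` (the count
  as a function of the four truth values; `gadgetCount_le` (`≤ 7`), `or_of_seven_le_gadgetCount`,
  `gadgetCount_dChoice` (`= 7` on satisfied clauses for the majority choice of `d`), all by `decide`),
  `MaxTwoSat.gjs` (fresh variables `numVars φ + i`), `MaxTwoSat.reduce` and its correctness
  **`MaxTwoSat.reduce_spec`**;
* the machine, in the typed `CodeFP` algebra (`CodeFP.lean`; no machine or growth estimate is written
  by hand): `MaxTwoSat.reduceFP : CodeFP cnfE (pairE cnfE natE) reduce`, guarded on strings by the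
  canonical-code test `KSATRed.isCanonFn` (pattern of `KSATReductions.lean`);
* **`kSAT_three_karpReducible_MAX2SAT : kSAT 3 ≤ₚ MAX2SAT`** and **`MAX2SAT_isNPHard`**.

Design notes. (1) The source is `kSAT 3` (clauses of AT MOST three literals, repetitions allowed,
possibly empty): a clause of width `1 ≤ k ≤ 3` is padded to three slots by repeating its last literal,
which does not change the gadget analysis (it is truth-functional in the three slot values); a CNF
with an empty clause (unsatisfiable) or of width `> 3` is sent to the fixed no-instance `([], 1)`.
(2) The fresh variable of clause `i` is `numVars φ + i` (`CNF.lt_numVars_of_mem_of_mem`). (3) First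
client: the NP-hardness of completion rank and border completion rank (Bläser–Ikenmeyer–Jindal–Lysikov
2018, Lemma 11 / Thm. 3, `Literature/Barriers/ValiantsHypothesis/BIJL18CompletionRankNPHardProofs.lean`),
whose printed proofs reduce from Max-2-SAT [ACG⁺99]. HONEST FRAMING: classical material; nothing here
bears on open problems.

## References

* [GareyJohnsonStockmeyer1976] M. R. Garey, D. S. Johnson, L. Stockmeyer, *Some simplified
  NP-complete graph problems*, Theoret. Comput. Sci. 1 (1976) 237–267, Thm. 1.1, p. 240 ("Max Sat2":
  "Disjunctive clauses `C₁, C₂, …, C_p`, each containing at most two literals, positive integer `k`.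
  Property: There is a truth assignment to the variables which satisfies `k` or more clauses … we
  now show that Sat3 can be reduced to Max Sat2, proving that Max Sat2 is NP-complete. … If any
  clause has fewer than 3 literals, we may replace it by an equivalent clause which has exactly 3
  literals, merely by repeating one of the literals which it contains … `k = 7m`. `7m` or more of
  the clauses in `S'` can be satisfied simultaneously if and only if the original set `S` is
  satisfiable"; text materialised as `paper:doi-10-1016-0304-3975-76-90059-1`, PDF p. 4).
* [GareyJohnson1979] M. R. Garey, D. S. Johnson, *Computers and Intractability* (1979), [LO5]
  MAXIMUM 2-SATISFIABILITY, p. 259 ("Transformation from 3SAT").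
* [Papadimitriou1994] C. H. Papadimitriou, *Computational Complexity* (1994), Thm. 9.2 (MAX2SAT is
  NP-complete; the same gadget).
* [AroraBarak2009] S. Arora, B. Barak, *Computational Complexity: A Modern Approach*, CUP 2009,
  Thm. 2.10 (2) (`3SAT` NP-complete), Def. 2.7 / Thm. 2.8 (Karp reductions), §1.3 (polynomial time
  is closed under composition and bounded loops), §0.1 (codes).
-/

noncomputable section

namespace Literature.Computability.Complexity

open _root_.Computability Brick NegCNF
open scoped Notation

/-! ### The number of satisfied clauses (the MAX-SAT objective) -/

namespace CNF

variable {ν : Type*}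

/-- **The number of clauses of `φ` satisfied by the assignment `σ`** (the MAX-SAT objective; cf.
`CNF.satisfiedFraction`, this count over the number of clauses). [cite: GareyJohnsonStockmeyer1976, §1 (MAX 2-SAT)] -/
def numSatClauses (φ : CNF ν) (σ : ν → Bool) : ℕ :=
  φ.countP fun c => c.eval σ

/-- No clause of the empty CNF is satisfied. [cite: AroraBarak2009, §11.2 (val(φ), MAX-SAT)] -/
@[simp] theorem numSatClauses_nil (σ : ν → Bool) : numSatClauses ([] : CNF ν) σ = 0 := rfl

/-- The count on a cons. [cite: AroraBarak2009, §11.2 (val(φ), MAX-SAT)] -/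
theorem numSatClauses_cons (c : Clause ν) (φ : CNF ν) (σ : ν → Bool) :
    numSatClauses (c :: φ) σ = numSatClauses φ σ + if c.eval σ then 1 else 0 := by
  unfold numSatClauses
  rw [List.countP_cons]

/-- The count is additive under concatenation. [cite: AroraBarak2009, §11.2 (val(φ), MAX-SAT)] -/
theorem numSatClauses_append (φ ψ : CNF ν) (σ : ν → Bool) :
    numSatClauses (φ ++ ψ) σ = numSatClauses φ σ + numSatClauses ψ σ := by
  unfold numSatClauses
  rw [List.countP_append]

/-- The count of a concatenation of blocks is the sum of the block counts. [cite: AroraBarak2009, §11.2 (val(φ), MAX-SAT)] -/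
theorem numSatClauses_flatten (L : List (CNF ν)) (σ : ν → Bool) :
    numSatClauses L.flatten σ = (L.map fun ψ => numSatClauses ψ σ).sum := by
  induction L with
  | nil => rfl
  | cons ψ L ih => rw [List.flatten_cons, numSatClauses_append, ih, List.map_cons, List.sum_cons]

/-- At most all clauses are satisfied. [cite: AroraBarak2009, §11.2 (val(φ) ≤ 1)] -/
theorem numSatClauses_le_length (φ : CNF ν) (σ : ν → Bool) : numSatClauses φ σ ≤ φ.length :=
  List.countP_le_length

/-- All clauses are satisfied iff the CNF is true. [cite: AroraBarak2009, §11.2 (val(φ) = 1 iff φ satisfiable)] -/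
theorem length_le_numSatClauses_iff (φ : CNF ν) (σ : ν → Bool) :
    φ.length ≤ numSatClauses φ σ ↔ φ.eval σ = true := by
  rw [numSatClauses, eval_eq_true_iff, ← List.countP_eq_length]
  exact ⟨fun h => le_antisymm List.countP_le_length h, fun h => h.ge⟩

end CNF

/-! ### The language `MAX2SAT` -/

/-- The code of an instance `(φ, b)`: a CNF code and a binary threshold. [cite: GareyJohnson1979, LO5 (p. 259)] -/
def encodingCNFNat : Encoding (CNF ℕ × ℕ) Bool :=
  encodingCNF.pairBool encodingNatBool

/-- **`MAX2SAT ⊆ {0,1}*`** (Garey–Johnson [LO5] MAXIMUM 2-SATISFIABILITY, decision version): codes of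
pairs `(φ, b)` with `φ` a 2-CNF — every clause has exactly two literal occurrences (`CNF.IsWidthEq 2`;
repetitions allowed, a unit clause `a` being written `a ∨ a`) — such that some assignment satisfies at
least `b` clauses of `φ`. [cite: GareyJohnson1979, LO5 (p. 259)] [cite: GareyJohnsonStockmeyer1976, Thm. 1.1] -/
def MAX2SAT : Language Bool :=
  encodingCNFNat.toLanguage {p | CNF.IsWidthEq 2 p.1 ∧ ∃ σ : ℕ → Bool, p.2 ≤ p.1.numSatClauses σ}

/-- Membership of a code in `MAX2SAT`. [cite: GareyJohnson1979, LO5 (p. 259)] -/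
theorem mem_MAX2SAT_iff (φ : CNF ℕ) (b : ℕ) :
    encodingCNFNat.encode (φ, b) ∈ MAX2SAT ↔
      CNF.IsWidthEq 2 φ ∧ ∃ σ : ℕ → Bool, b ≤ φ.numSatClauses σ :=
  encodingCNFNat.mem_toLanguage_iff _ (φ, b)

/-! ### The Garey–Johnson–Stockmeyer gadget -/

namespace MaxTwoSat

open CNF

/-- **Slot `j ∈ {0,1,2}` of a clause of width `≤ 3`**: its `j`-th literal, padded by repeating the last
literal (junk `x₀̄` on the empty clause, never used). [folklore] -/
def slot (c : Clause ℕ) (j : ℕ) : Literal ℕ :=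
  c.getD (min j (c.length - 1)) (0, false)

/-- A slot of a non-empty clause is one of its literals. [cite: GareyJohnsonStockmeyer1976, Thm. 1.1 (proof: "repeating one of the literals which it contains")] -/
theorem slot_mem {c : Clause ℕ} (hc : c ≠ []) (j : ℕ) : slot c j ∈ c := by
  have hlen : 0 < c.length := List.length_pos_of_ne_nil hc
  have hlt : min j (c.length - 1) < c.length := by omega
  rw [slot, List.getD_eq_getElem _ _ hlt]
  exact List.getElem_mem hlt

/-- Every literal of a clause of width `≤ 3` occupies one of the three slots. [cite: GareyJohnsonStockmeyer1976, Thm. 1.1 (proof)] -/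
theorem exists_slot_eq {c : Clause ℕ} (h3 : c.length ≤ 3) {l : Literal ℕ} (hl : l ∈ c) :
    ∃ j < 3, slot c j = l := by
  obtain ⟨i, hi, rfl⟩ := List.mem_iff_getElem.1 hl
  refine ⟨i, by omega, ?_⟩
  rw [slot, min_eq_left (by omega), List.getD_eq_getElem _ _ hi]

/-- **The value of a clause of width `1 ≤ k ≤ 3` is the disjunction of its three slots** ("an equivalent
clause which has exactly 3 literals"). [cite: GareyJohnsonStockmeyer1976, Thm. 1.1 (proof)] -/
theorem eval_eq_slots {c : Clause ℕ} (hc : c ≠ []) (h3 : c.length ≤ 3) (σ : ℕ → Bool) :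
    c.eval σ = ((slot c 0).eval σ || (slot c 1).eval σ || (slot c 2).eval σ) := by
  rw [Bool.eq_iff_iff]
  constructor
  · intro h
    obtain ⟨l, hl, hlv⟩ := List.any_eq_true.1 h
    obtain ⟨j, hj, rfl⟩ := exists_slot_eq h3 hl
    interval_cases j <;> simp [hlv]
  · intro h
    rw [Clause.eval, List.any_eq_true]
    rcases Bool.or_eq_true_iff.1 h with h | h
    · rcases Bool.or_eq_true_iff.1 h with h | h
      · exact ⟨_, slot_mem hc 0, h⟩
      · exact ⟨_, slot_mem hc 1, h⟩
    · exact ⟨_, slot_mem hc 2, h⟩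

/-- **The ten clauses of Garey–Johnson–Stockmeyer** for a clause with slots `a, b, c` and the fresh
literal `d`: `a, b, c, d, ¬a ∨ ¬b, ¬a ∨ ¬c, ¬b ∨ ¬c, a ∨ ¬d, b ∨ ¬d, c ∨ ¬d` (unit clauses doubled).
[cite: GareyJohnsonStockmeyer1976, Thm. 1.1 (proof)] [cite: Papadimitriou1994, Thm. 9.2 (proof)] -/
def gadget (a b c d : Literal ℕ) : CNF ℕ :=
  [[a, a], [b, b], [c, c], [d, d], [a.negate, b.negate], [a.negate, c.negate], [b.negate, c.negate],
    [a, d.negate], [b, d.negate], [c, d.negate]]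

/-- The number of satisfied gadget clauses as a function of the four truth values. [cite: GareyJohnsonStockmeyer1976, Thm. 1.1 (proof)] -/
def gadgetCount (x y z w : Bool) : ℕ :=
  x.toNat + y.toNat + z.toNat + w.toNat + (!x || !y).toNat + (!x || !z).toNat + (!y || !z).toNat +
    (x || !w).toNat + (y || !w).toNat + (z || !w).toNat

/-- The majority of the three slot values: a choice of the fresh variable achieving `7`. [cite: GareyJohnsonStockmeyer1976, Thm. 1.1 (proof: "in all three cases, there is a truth setting")] -/
def dChoice (x y z : Bool) : Bool := (x && y) || (x && z) || (y && z)

/-- **The gadget count is truth-functional.** [cite: GareyJohnsonStockmeyer1976, Thm. 1.1 (proof)] -/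
theorem numSatClauses_gadget (a b c d : Literal ℕ) (σ : ℕ → Bool) :
    (gadget a b c d).numSatClauses σ = gadgetCount (a.eval σ) (b.eval σ) (c.eval σ) (d.eval σ) := by
  cases ha : a.eval σ <;> cases hb : b.eval σ <;> cases hc : c.eval σ <;> cases hd : d.eval σ <;>
    simp [gadget, numSatClauses, Clause.eval, ha, hb, hc, hd, gadgetCount]

/-- **At most seven of the ten clauses hold.** [cite: GareyJohnsonStockmeyer1976, Thm. 1.1 (proof)] -/
theorem gadgetCount_le (x y z w : Bool) : gadgetCount x y z w ≤ 7 := by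
  revert x y z w; decide

/-- **Seven hold only if the clause holds.** [cite: GareyJohnsonStockmeyer1976, Thm. 1.1 (proof)] -/
theorem or_of_seven_le_gadgetCount {x y z w : Bool} (h : 7 ≤ gadgetCount x y z w) :
    (x || y || z) = true := by
  revert x y z w; decide

/-- **If the clause holds, the majority choice of `d` makes exactly seven hold.** [cite: GareyJohnsonStockmeyer1976, Thm. 1.1 (proof)] -/
theorem gadgetCount_dChoice {x y z : Bool} (h : (x || y || z) = true) :
    gadgetCount x y z (dChoice x y z) = 7 := by
  revert x y z; decide

/-- Every gadget clause has exactly two literal occurrences. [cite: GareyJohnsonStockmeyer1976, Thm. 1.1 (proof)] -/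
theorem isWidthEq_two_gadget (a b c d : Literal ℕ) : IsWidthEq 2 (gadget a b c d) := by
  intro cl h
  simp only [gadget, List.mem_cons, List.not_mem_nil, or_false] at h
  rcases h with rfl | rfl | rfl | rfl | rfl | rfl | rfl | rfl | rfl | rfl <;> rfl

/-- The gadget has ten clauses ("the ten clauses"). [cite: GareyJohnsonStockmeyer1976, Thm. 1.1 (proof)] -/
@[simp] theorem length_gadget (a b c d : Literal ℕ) : (gadget a b c d).length = 10 := rfl

/-- **The gadget of clause `i`** (fresh variable `B + i`). [cite: GareyJohnsonStockmeyer1976, Thm. 1.1 (proof)] -/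
def clauseGadget (B i : ℕ) (c : Clause ℕ) : CNF ℕ :=
  gadget (slot c 0) (slot c 1) (slot c 2) (B + i, true)

/-- **The Garey–Johnson–Stockmeyer 2-CNF of `φ`**: the gadgets of its clauses, fresh variables
`numVars φ + i`. [cite: GareyJohnsonStockmeyer1976, Thm. 1.1 (proof)] [cite: GareyJohnson1979, LO5 (p. 259)] -/
def gjs (φ : CNF ℕ) : CNF ℕ :=
  (φ.mapIdx (clauseGadget φ.numVars)).flatten

/-- The items of `mapIdx`. [folklore] -/
private theorem mem_mapIdx_iff {α β : Type*} (f : ℕ → α → β) (l : List α) (y : β) :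
    y ∈ l.mapIdx f ↔ ∃ (i : ℕ) (h : i < l.length), f i l[i] = y := by
  rw [List.mem_iff_getElem]
  constructor
  · rintro ⟨i, hi, rfl⟩
    rw [List.length_mapIdx] at hi
    exact ⟨i, hi, by rw [List.getElem_mapIdx]⟩
  · rintro ⟨i, hi, rfl⟩
    exact ⟨i, by rw [List.length_mapIdx]; exact hi, by rw [List.getElem_mapIdx]⟩

/-- `gjs φ` is a 2-CNF. [cite: GareyJohnsonStockmeyer1976, Thm. 1.1] -/
theorem isWidthEq_two_gjs (φ : CNF ℕ) : IsWidthEq 2 (gjs φ) := by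
  intro cl h
  obtain ⟨G, hG, hcl⟩ := List.mem_flatten.1 h
  obtain ⟨i, hi, rfl⟩ := (mem_mapIdx_iff _ _ _).1 hG
  exact isWidthEq_two_gadget _ _ _ _ cl hcl

/-- `gjs φ` has `10 m` clauses. [cite: GareyJohnsonStockmeyer1976, Thm. 1.1] -/
theorem length_gjs (φ : CNF ℕ) : (gjs φ).length = 10 * φ.length := by
  have h : ∀ (L : List (CNF ℕ)), (∀ G ∈ L, G.length = 10) → (L.map List.length).sum = 10 * L.length := by
    intro L hL
    induction L with
    | nil => rfl
    | cons G L ih =>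
      rw [List.map_cons, List.sum_cons, hL G List.mem_cons_self, ih fun G' h' => hL G' (List.mem_cons_of_mem _ h'),
        List.length_cons]
      ring
  rw [gjs, List.length_flatten, h _ fun G hG => ?_, List.length_mapIdx]
  obtain ⟨i, hi, rfl⟩ := (mem_mapIdx_iff _ _ _).1 hG
  rfl

/-- A sum of terms bounded by `7` reaches `7 ·` the number of terms only if every term is `7`.
[folklore] -/
private theorem forall_eq_of_sum_ge {α : Type*} (f : α → ℕ) (l : List α) (hle : ∀ x ∈ l, f x ≤ 7)
    (hsum : 7 * l.length ≤ (l.map f).sum) : ∀ x ∈ l, 7 ≤ f x := by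
  induction l with
  | nil => intro x hx; simp at hx
  | cons a l ih =>
    have ha := hle a List.mem_cons_self
    have hl : (l.map f).sum ≤ 7 * l.length := by
      have := List.sum_le_card_nsmul (l.map f) 7 fun y hy => by
        obtain ⟨x, hx, rfl⟩ := List.mem_map.1 hy
        exact hle x (List.mem_cons_of_mem _ hx)
      rw [List.length_map, smul_eq_mul] at this
      omega
    rw [List.map_cons, List.sum_cons, List.length_cons] at hsum
    intro x hx
    rcases List.mem_cons.1 hx with rfl | hx
    · omega
    · exact ih (fun y hy => hle y (List.mem_cons_of_mem _ hy)) (by omega) x hx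

/-- A sum of terms all equal to `7`. [folklore] -/
private theorem sum_eq_of_forall_eq {α : Type*} (f : α → ℕ) (l : List α) (h : ∀ x ∈ l, f x = 7) :
    (l.map f).sum = 7 * l.length := by
  induction l with
  | nil => rfl
  | cons a l ih =>
    rw [List.map_cons, List.sum_cons, h a List.mem_cons_self, ih fun x hx => h x (List.mem_cons_of_mem _ hx),
      List.length_cons]
    ring

/-- **Soundness of the gadget reduction**: if `7 m` clauses of `gjs φ` are satisfied by `τ` (`φ` of
width `≤ 3` without empty clauses) then `τ` satisfies `φ`. [cite: GareyJohnsonStockmeyer1976, Thm. 1.1 (proof)] -/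
theorem eval_of_le_numSatClauses_gjs {φ : CNF ℕ} (h3 : φ.IsWidthLE 3) (h0 : [] ∉ φ) {τ : ℕ → Bool}
    (h : 7 * φ.length ≤ (gjs φ).numSatClauses τ) : φ.eval τ = true := by
  rw [gjs, numSatClauses_flatten] at h
  set L := φ.mapIdx (clauseGadget φ.numVars) with hL
  have hlen : L.length = φ.length := by rw [hL, List.length_mapIdx]
  have hall := forall_eq_of_sum_ge (fun ψ => ψ.numSatClauses τ) L (fun G hG => ?_) (by rw [hlen]; exact h)
  · rw [eval_eq_true_iff]
    intro c hc
    obtain ⟨i, hi, rfl⟩ := List.mem_iff_getElem.1 hc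
    have hmem : clauseGadget φ.numVars i φ[i] ∈ L := (mem_mapIdx_iff _ _ _).2 ⟨i, hi, rfl⟩
    have h7 := hall _ hmem
    simp only [clauseGadget, numSatClauses_gadget] at h7
    have hne : φ[i] ≠ [] := fun he => h0 (he ▸ hc)
    rw [eval_eq_slots hne (h3 _ hc)]
    exact or_of_seven_le_gadgetCount h7
  · obtain ⟨i, hi, rfl⟩ := (mem_mapIdx_iff _ _ _).1 hG
    simp only [clauseGadget, numSatClauses_gadget]
    exact gadgetCount_le _ _ _ _

/-- **The assignment of the completeness direction**: `σ` below the fresh block `B = numVars φ`, the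
majority choices above it. [cite: GareyJohnsonStockmeyer1976, Thm. 1.1 (proof)] -/
def extend (φ : CNF ℕ) (σ : ℕ → Bool) : ℕ → Bool := fun v =>
  if v < φ.numVars then σ v else
    dChoice ((slot (φ.getD (v - φ.numVars) []) 0).eval σ) ((slot (φ.getD (v - φ.numVars) []) 1).eval σ)
      ((slot (φ.getD (v - φ.numVars) []) 2).eval σ)

/-- The extended assignment agrees with `σ` on the literals of `φ`. [cite: GareyJohnsonStockmeyer1976, Thm. 1.1 (proof)] -/
theorem eval_extend_of_mem {φ : CNF ℕ} {c : Clause ℕ} (hc : c ∈ φ) {l : Literal ℕ} (hl : l ∈ c)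
    (σ : ℕ → Bool) : l.eval (extend φ σ) = l.eval σ := by
  simp only [Literal.eval, extend, if_pos (lt_numVars_of_mem_of_mem hc hl)]

/-- **Completeness of the gadget reduction**: a satisfying assignment of `φ` (width `≤ 3`, no empty
clause) extends to one satisfying exactly `7 m` clauses of `gjs φ`. [cite: GareyJohnsonStockmeyer1976, Thm. 1.1 (proof)] -/
theorem numSatClauses_gjs_extend {φ : CNF ℕ} (h3 : φ.IsWidthLE 3) (h0 : [] ∉ φ) {σ : ℕ → Bool}
    (hσ : φ.eval σ = true) : (gjs φ).numSatClauses (extend φ σ) = 7 * φ.length := by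
  rw [gjs, numSatClauses_flatten]
  have hall : ∀ G ∈ φ.mapIdx (clauseGadget φ.numVars), (fun ψ => ψ.numSatClauses (extend φ σ)) G = 7 := by
    intro G hG
    obtain ⟨i, hi, rfl⟩ := (mem_mapIdx_iff _ _ _).1 hG
    have hc : φ[i] ∈ φ := List.getElem_mem hi
    have hne : φ[i] ≠ [] := fun he => h0 (he ▸ hc)
    simp only
    rw [clauseGadget, numSatClauses_gadget, eval_extend_of_mem hc (slot_mem hne 0),
      eval_extend_of_mem hc (slot_mem hne 1), eval_extend_of_mem hc (slot_mem hne 2)]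
    have hd : Literal.eval (extend φ σ) (φ.numVars + i, true) =
        dChoice ((slot φ[i] 0).eval σ) ((slot φ[i] 1).eval σ) ((slot φ[i] 2).eval σ) := by
      simp only [Literal.eval, extend, if_neg (Nat.not_lt.2 (Nat.le_add_right _ _)), Nat.add_sub_cancel_left,
        List.getD_eq_getElem _ _ hi, beq_true]
    rw [hd]
    apply gadgetCount_dChoice
    rw [← eval_eq_slots hne (h3 _ hc)]
    exact (eval_eq_true_iff φ σ).1 hσ _ hc
  rw [sum_eq_of_forall_eq _ _ hall, List.length_mapIdx]

/-- **The instance map** of the reduction `3SAT ≤ₚ MAX2SAT` on formulas: `(gjs φ, 7 m)` for a CNF of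
width `≤ 3` without empty clauses, the no-instance `([], 1)` otherwise.
[cite: GareyJohnsonStockmeyer1976, Thm. 1.1] [cite: GareyJohnson1979, LO5 (p. 259)] -/
def reduce (φ : CNF ℕ) : CNF ℕ × ℕ :=
  if φ.IsWidthLE 3 ∧ [] ∉ φ then (gjs φ, 7 * φ.length) else ([], 1)

/-- **Correctness of the instance map**: `reduce φ` is a yes-instance of MAX 2-SAT iff `φ` is a
satisfiable CNF of width `≤ 3`. [cite: GareyJohnsonStockmeyer1976, Thm. 1.1] -/
theorem reduce_spec (φ : CNF ℕ) :
    (IsWidthEq 2 (reduce φ).1 ∧ ∃ τ : ℕ → Bool, (reduce φ).2 ≤ (reduce φ).1.numSatClauses τ) ↔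
      φ.IsWidthLE 3 ∧ φ.Satisfiable := by
  unfold reduce
  by_cases hg : φ.IsWidthLE 3 ∧ [] ∉ φ
  · rw [if_pos hg]
    constructor
    · rintro ⟨-, τ, hτ⟩
      exact ⟨hg.1, τ, eval_of_le_numSatClauses_gjs hg.1 hg.2 hτ⟩
    · rintro ⟨-, σ, hσ⟩
      exact ⟨isWidthEq_two_gjs φ, extend φ σ, (numSatClauses_gjs_extend hg.1 hg.2 hσ).ge⟩
  · rw [if_neg hg]
    simp only [numSatClauses_nil, nonpos_iff_eq_zero, one_ne_zero, exists_const, and_false, false_iff,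
      not_and]
    intro h3 hsat
    exact hg ⟨h3, fun h0 => not_satisfiable_of_nil_mem h0 hsat⟩

/-- Membership of the code of `reduce φ` in `MAX2SAT`. [cite: GareyJohnsonStockmeyer1976, Thm. 1.1] -/
theorem encode_reduce_mem_iff (φ : CNF ℕ) :
    encodingCNFNat.encode (reduce φ) ∈ MAX2SAT ↔ φ.IsWidthLE 3 ∧ φ.Satisfiable := by
  rw [show reduce φ = ((reduce φ).1, (reduce φ).2) from rfl, mem_MAX2SAT_iff]
  exact reduce_spec φ

/-! ### The machine: `reduce` on codes, in the typed `CodeFP` algebra -/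

open CodeFP

/-- The code of a literal: `boolPair ⌜v⌝ [polarity]`. [cite: AroraBarak2009, §0.1] -/
abbrev litE : Literal ℕ → List Bool := pairE natE bitE

/-- The code of a CNF: `encodingCNF`, i.e. `listE (listE litE)` (a twin of the same-named codes of
`E3InstanceMachine.lean` / `AOWProgramFP.lean`, files not imported here). [cite: Cook1971, §1 (CNF codes)] -/
def cnfE : CNF ℕ → List Bool := listE (listE litE)

/-- `cnfE` is `encodingCNF.encode`. [cite: AroraBarak2009, §0.1 (codes of lists and pairs)] -/
theorem cnfE_eq : (encodingCNF.encode : CNF ℕ → List Bool) = cnfE := by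
  unfold cnfE encodingCNF encodingClause encodingLiteral
  rw [listE_eq, listE_eq, pairE_eq, natE_eq, bitE_eq]

/-- The instance code is `pairE cnfE natE`. [cite: AroraBarak2009, §0.1 (codes of lists and pairs)] -/
theorem encodingCNFNat_eq : (encodingCNFNat.encode : CNF ℕ × ℕ → List Bool) = pairE cnfE natE := by
  unfold encodingCNFNat
  rw [pairE_eq, cnfE_eq, natE_eq]

/-- The clauses as a raw list of raw clauses. [cite: AroraBarak2009, §1.3] -/
theorem clausesFP : CodeFP cnfE (rawE (rawE litE)) (fun φ : CNF ℕ => φ) :=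
  ((map₀ (rawOfList litE)).comp (rawOfList (listE litE))).congr fun φ => by simp

/-- A raw list of raw clauses as a CNF code. [cite: AroraBarak2009, §1.3] -/
theorem cnfOfRawFP : CodeFP (rawE (rawE litE)) cnfE (fun φ : CNF ℕ => φ) :=
  ((listOfRaw (listE litE)).comp (map₀ (listOfRaw litE))).congr fun φ => by simp

/-- The number of clauses (binary). [cite: AroraBarak2009, §1.3] -/
theorem lengthFP : CodeFP cnfE natE (fun φ : CNF ℕ => φ.length) :=
  ((natLength (listE litE)).comp (rawOfList (listE litE))).congr fun _ => rfl

/-- The maximum fold from the left equals the one from the right (twin of the lemma of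
`E3InstanceMachine.lean`, not imported here). [folklore] -/
private theorem foldl_max_eq_foldr_max : ∀ (l : List ℕ) (acc : ℕ), l.foldl max acc = max acc (l.foldr max 0)
  | [], acc => by simp
  | a :: l, acc => by rw [List.foldl_cons, List.foldr_cons, foldl_max_eq_foldr_max l, max_assoc]

/-- A maximum fold is `0` or a member. [folklore] -/
private theorem foldr_max_mem_or (l : List ℕ) : l.foldr max 0 = 0 ∨ l.foldr max 0 ∈ l := by
  induction l with
  | nil => left; rfl
  | cons a l ih =>
    rw [List.foldr_cons]
    rcases le_total a (l.foldr max 0) with h | h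
    · rw [max_eq_right h]
      rcases ih with h0 | hm
      · rw [h0] at h ⊢; left; rfl
      · right; exact List.mem_cons_of_mem _ hm
    · rw [max_eq_left h]; right; exact List.mem_cons_self

/-- **The maximum of a raw list of numerals** (`foldr max 0`; twin of `CodeFP.natMaxList` of
`E3InstanceMachine.lean`, whose expander stack is deliberately not imported here; private). [cite: AroraBarak2009, §1.3] -/
private theorem natMaxListFP : CodeFP (rawE natE) natE (fun l => l.foldr max 0) := by
  have hstep : CodeFP (pairE natE natE) natE (fun t => max t.2 t.1) :=
    (natMax.comp ((snd _ _).pair (fst _ _))).congr fun _ => rfl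
  have h := foldl₀ (α := ℕ) (β := ℕ) (eα := natE) (eβ := natE) (step := fun a b => max b a) (b₀ := 0) hstep
    Polynomial.X fun l₁ l₂ => by
    rw [Polynomial.eval_X, show (l₁.foldl (fun b a => max b a) 0) = l₁.foldl max 0 from rfl,
      foldl_max_eq_foldr_max, Nat.zero_max]
    rcases foldr_max_mem_or l₁ with h0 | hm
    · rw [h0]; exact (length_natE_le 0).trans (Nat.zero_le _)
    · exact le_trans (by omega) (length_item_le_length_rawE natE (List.mem_append_left l₂ hm))
  exact h.congr fun l => by
    rw [show (l.foldl (fun b a => max b a) 0) = l.foldl max 0 from rfl, foldl_max_eq_foldr_max l 0, Nat.zero_max]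

/-- **`numVars`** on codes. [cite: AroraBarak2009, §1.3] -/
theorem numVarsFP : CodeFP cnfE natE CNF.numVars := by
  have hlits : CodeFP cnfE (rawE litE) (fun φ : CNF ℕ => φ.flatten) :=
    ((flatten litE).comp clausesFP).congr fun _ => rfl
  have hitem : CodeFP litE natE (fun l : Literal ℕ => l.1 + 1) :=
    (natAdd.comp ((fst _ _).pair (const _ 1))).congr fun _ => rfl
  exact (natMaxListFP.comp ((map₀ hitem).comp hlits)).congr fun _ => rfl

/-- **The slots** on codes. [cite: AroraBarak2009, §1.3] -/
theorem slotFP : CodeFP (pairE (rawE litE) natE) litE (fun p => slot p.1 p.2) := by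
  have hidx : CodeFP (pairE (rawE litE) natE) natE (fun p => min p.2 (p.1.length - 1)) :=
    (natMin.comp ((snd _ _).pair (natSub.comp (((natLength litE).comp (fst _ _)).pair (const _ 1))))).congr
      fun _ => rfl
  exact ((rawGetOr litE).comp ((fst _ _).pair (hidx.pair (const _ (((0 : ℕ), false) : Literal ℕ))))).congr
    fun _ => rfl

/-- Negation of a literal on codes. [cite: AroraBarak2009, §1.3] -/
theorem negateFP : CodeFP litE litE Literal.negate :=
  ((fst natE bitE).pair (snd natE bitE).not).congr fun _ => rfl

variable {α : Type} {eα : α → List Bool}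

/-- A two-literal clause on codes. [cite: AroraBarak2009, §1.3] -/
theorem clause₂FP {g h : α → Literal ℕ} (hg : CodeFP eα litE g) (hh : CodeFP eα litE h) :
    CodeFP eα (rawE litE) (fun a => [g a, h a]) :=
  ((rawCons litE).comp (hg.pair ((rawSingleton litE).comp hh))).congr fun _ => rfl

/-- `cons` of a computed clause onto a computed clause list. [cite: AroraBarak2009, §1.3] -/
theorem consFP {g : α → Clause ℕ} {h : α → CNF ℕ} (hg : CodeFP eα (rawE litE) g) (hh : CodeFP eα (rawE (rawE litE)) h) :
    CodeFP eα (rawE (rawE litE)) (fun a => g a :: h a) :=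
  ((rawCons (rawE litE)).comp (hg.pair hh)).congr fun _ => rfl

/-- **The ten gadget clauses** on codes (context: the four literals). [cite: GareyJohnsonStockmeyer1976, Thm. 1.1 (proof)] -/
theorem gadgetFP : CodeFP (pairE litE (pairE litE (pairE litE litE))) (rawE (rawE litE))
    (fun t => gadget t.1 t.2.1 t.2.2.1 t.2.2.2) := by
  have ha : CodeFP (pairE litE (pairE litE (pairE litE litE))) litE (fun t => t.1) := fst _ _
  have hb : CodeFP (pairE litE (pairE litE (pairE litE litE))) litE (fun t => t.2.1) := (snd _ _).fst'
  have hc : CodeFP (pairE litE (pairE litE (pairE litE litE))) litE (fun t => t.2.2.1) := (snd _ _).snd'.fst'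
  have hd : CodeFP (pairE litE (pairE litE (pairE litE litE))) litE (fun t => t.2.2.2) := (snd _ _).snd'.snd'
  have hna := negateFP.comp ha
  have hnb := negateFP.comp hb
  have hnc := negateFP.comp hc
  have hnd := negateFP.comp hd
  exact (consFP (clause₂FP ha ha) (consFP (clause₂FP hb hb) (consFP (clause₂FP hc hc) (consFP (clause₂FP hd hd)
    (consFP (clause₂FP hna hnb) (consFP (clause₂FP hna hnc) (consFP (clause₂FP hnb hnc)
    (consFP (clause₂FP ha hnd) (consFP (clause₂FP hb hnd) (consFP (clause₂FP hc hnd)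
    (const _ ([] : CNF ℕ)))))))))))).congr fun _ => rfl

/-- **The gadget of clause `i`** on codes (context `(B, i, c)`). [cite: GareyJohnsonStockmeyer1976, Thm. 1.1 (proof)] -/
theorem clauseGadgetFP :
    CodeFP (pairE natE (pairE natE (rawE litE))) (rawE (rawE litE)) (fun t => clauseGadget t.1 t.2.1 t.2.2) := by
  have hcl : CodeFP (pairE natE (pairE natE (rawE litE))) (rawE litE) (fun t => t.2.2) := (snd _ _).snd'
  have hs : ∀ j : ℕ, CodeFP (pairE natE (pairE natE (rawE litE))) litE (fun t => slot t.2.2 j) := fun j =>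
    (slotFP.comp (hcl.pair (const _ j))).congr fun _ => rfl
  have hd : CodeFP (pairE natE (pairE natE (rawE litE))) litE (fun t => ((t.1 + t.2.1 : ℕ), true)) :=
    (natAdd.comp ((fst _ _).pair (snd _ _).fst')).pair (const _ true)
  exact (gadgetFP.comp ((hs 0).pair ((hs 1).pair ((hs 2).pair hd)))).congr fun _ => rfl

/-- **`gjs` on codes** (an indexed map with the context `numVars φ`, then a flatten).
[cite: GareyJohnsonStockmeyer1976, Thm. 1.1] [cite: AroraBarak2009, §1.3] -/
theorem gjsFP : CodeFP cnfE (rawE (rawE litE)) gjs :=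
  ((flatten (rawE litE)).comp ((mapIdx clauseGadgetFP).comp (numVarsFP.pair clausesFP))).congr fun _ => rfl

/-- **The guard** "width `≤ 3` and no empty clause" on codes. [cite: AroraBarak2009, §1.3] -/
theorem isGoodFP : CodeFP cnfE bitE (fun φ : CNF ℕ => decide (φ.IsWidthLE 3 ∧ [] ∉ φ)) := by
  have hw : CodeFP (pairE unitE (rawE litE)) bitE (fun q => decide (q.2.length ≤ 3)) :=
    (natLe.comp (((natLength litE).comp (snd _ _)).pair (const _ 3))).congr fun _ => rfl
  have hall : CodeFP cnfE bitE (fun φ : CNF ℕ => φ.all fun c => decide (c.length ≤ 3)) :=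
    ((all hw).comp ((const _ ()).pair clausesFP)).congr fun _ => rfl
  have he : CodeFP (pairE unitE (rawE litE)) bitE (fun q => q.2.isEmpty) := (rawIsEmpty litE).comp (snd _ _)
  have hany : CodeFP cnfE bitE (fun φ : CNF ℕ => φ.any fun c => c.isEmpty) :=
    ((any he).comp ((const _ ()).pair clausesFP)).congr fun _ => rfl
  refine (hall.and hany.not).congr fun φ => ?_
  rw [Bool.eq_iff_iff, Bool.and_eq_true, Bool.not_eq_true', List.all_eq_true, List.any_eq_false,
    decide_eq_true_iff]
  simp only [decide_eq_true_iff, List.isEmpty_iff]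
  exact ⟨fun h => ⟨fun c hc => h.1 c hc, fun h0 => h.2 _ h0 rfl⟩, fun h => ⟨fun c hc => h.1 c hc,
    fun c hc he => h.2 (he ▸ hc)⟩⟩

/-- **The instance map `reduce` is computed on codes by a polynomial-time string function.**
[cite: GareyJohnsonStockmeyer1976, Thm. 1.1] [cite: AroraBarak2009, §1.3] -/
theorem reduceFP : CodeFP cnfE (pairE cnfE natE) reduce := by
  have hyes : CodeFP cnfE (pairE cnfE natE) (fun φ => (gjs φ, 7 * φ.length)) :=
    (cnfOfRawFP.comp gjsFP).pair (natMul.comp ((const _ 7).pair lengthFP))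
  refine (isGoodFP.ite hyes (const _ ((([] : CNF ℕ), (1 : ℕ)) : CNF ℕ × ℕ))).congr fun φ => ?_
  unfold reduce
  simp only [decide_eq_true_eq]

/-! ### `3SAT ≤ₚ MAX2SAT` and the NP-hardness of `MAX2SAT` -/

/-- The fixed non-member `([], 1)` (no clause can be satisfied). [cite: GareyJohnson1979, LO5 (p. 259)] -/
def badCode : List Bool := encodingCNFNat.encode (([] : CNF ℕ), 1)

/-- `badCode ∉ MAX2SAT`. [cite: GareyJohnson1979, LO5 (p. 259)] -/
theorem badCode_not_mem_MAX2SAT : badCode ∉ MAX2SAT := fun h => by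
  obtain ⟨-, σ, hσ⟩ := (mem_MAX2SAT_iff _ _).1 h
  simp at hσ

/-- **`3SAT ≤ₚ MAX2SAT`** (Garey–Johnson–Stockmeyer 1976; `3SAT = kSAT 3`): a CNF code is sent to the
code of `reduce` of its decoding, every other string to `badCode`.
[cite: GareyJohnsonStockmeyer1976, Thm. 1.1] [cite: GareyJohnson1979, LO5 (p. 259)] -/
theorem kSAT_three_karpReducible_MAX2SAT : kSAT 3 ≤ₚ MAX2SAT := by
  obtain ⟨f, hf, hfr⟩ := reduceFP
  refine ⟨iteFn KSATRed.isCanonFn f (fun _ => badCode),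
    iteFn_mem_FP KSATRed.isCanonFn_mem_FP hf (const_mem_FP _), fun x => ?_⟩
  show x ∈ kSAT 3 ↔ iteFn KSATRed.isCanonFn f (fun _ => badCode) x ∈ MAX2SAT
  by_cases hx : encodingCNF.encode (decCNF x) = x
  · have hc : KSATRed.isCanonFn x = [true] := by rw [KSATRed.isCanonFn_apply]; simp [hx]
    rw [iteFn_apply_true hc, ← hx, mem_kSAT_iff, cnfE_eq, hfr, ← encodingCNFNat_eq, encode_reduce_mem_iff]
  · have hc : KSATRed.isCanonFn x = [false] := by rw [KSATRed.isCanonFn_apply]; simp [hx]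
    rw [iteFn_apply_false hc]
    exact ⟨fun h => (hx (KSATRed.encode_decCNF_of_mem h)).elim, fun h => (badCode_not_mem_MAX2SAT h).elim⟩

end MaxTwoSat

/-- **MAX 2-SAT is NP-hard** (Garey–Johnson–Stockmeyer 1976): `3SAT` is NP-complete
(`isNPComplete_kSAT_three_holds`, Arora–Barak Thm. 2.10 (2)) and `kSAT 3 ≤ₚ MAX2SAT`, hardness
propagating along the reduction (`IsHard.of_reducible_holds`).
[cite: GareyJohnsonStockmeyer1976, Thm. 1.1] [cite: GareyJohnson1979, LO5 (p. 259)] -/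
theorem MAX2SAT_isNPHard : IsNPHard MAX2SAT :=
  IsHard.of_reducible_holds (isNPComplete_kSAT_three_holds : IsNPComplete (kSAT 3)).isHard
    MaxTwoSat.kSAT_three_karpReducible_MAX2SAT

end Literature.Computability.Complexity
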